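import Literature.NumberTheory.Transcendental.PadicCW77Functions
import Literature.NumberTheory.Transcendental.PadicNewtonTaylorDeriv
import HarnessLib

/-!
# The `p`-adic Cijsouw–Waldschmidt functions as power series: coefficients, weighted bound, jets

Support file (definitions and proved theorems; no named fact), sequel to
`PadicCW77Functions.lean` (cell `abc-stewartyu`, WP-A2 ↔ WP-A1 interface). The auxiliary
function `f_{J,τ}(z) = ∑_u p(u) · Dw(z) · A · exp(expo(u) z)` of `S : PadicCW77.Setup` is a power
series `∑ₙ coeffF n · zⁿ` on the disc `‖z‖ < √p` (`hasSum_coeffF`), whose coefficients satisfy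
the weighted bound `‖coeffF n‖ (√p)ⁿ ≤ p^{h·Lb}` (`wtBdd_coeffF`: the `p(u)` are integers,
`‖A‖ ≤ 1`, `‖expo^j/j!‖ (√p)^j ≤ 1` since `‖expo‖ ≤ p⁻¹` and `‖1/j!‖ ≤ p^{(j-1)/2}`, and the
coefficients of the `Δ`-polynomial `(d/dX)^{τ₀} w_{r,l}(cX)` are integers divided by
`wDen = r! h!ˡ`, `‖wDen⁻¹‖ (√p)^{deg} ≤ p^{deg} < p^{h Lb}`). Hence the small-jets Schwarz lemma
(`PadicNewton.norm_tsum_le_max_of_small_jets`, radius `ρ = √p`, nodes in `‖z‖ ≤ 1`) applies to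
`f_{J,τ}`, with its jets controlled by the values of the `f_{J,τ'}` through
`PadicNewton.norm_jet_le_norm_iteratedDeriv` and `norm_iteratedDeriv_F_le_of_forall`
(`norm_jet_F_le`).

## References
* [Yu1990] K. Yu, *Linear forms in p-adic logarithms II*, Compositio Math. 74 (1990), §§2–3.
* [CijsouwWaldschmidt1977] P. L. Cijsouw, M. Waldschmidt, Compositio Math. 34 (1977), §4.
-/

noncomputable section

open NormedSpace Finset IsUltrametricDist Polynomial Metric Filter
open Literature.NumberTheory.Transcendental.Baker1975 (bump bump_apply sum_bump)
open Literature.NumberTheory.Transcendental.Baker1975.Ch3 (wPoly wDen Slot slotVal)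
open scoped Nat Topology

namespace Literature.NumberTheory.Transcendental

namespace PadicCW77

open CW77.Setup (Idx Tau tauNorm bump0 bumpj bumpτ tauNorm_bumpτ)

namespace Setup

variable (S : Setup) {h Lb : ℕ}

/-! ### The `Δ`-polynomial has coefficients in `wDen⁻¹ ℤ` -/

/-- **Integrality of the `Δ`-polynomial**: `(d/dX)^{k} [w_{a,b}(cX)] = wDen⁻¹ · P` with
`P ∈ ℤ[X]` (`w_{a,b} = wDen⁻¹ ∏_{slots}(X + v)`). [cite: CijsouwWaldschmidt1977, §4 Lemma 8 (p. 185)] -/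
theorem exists_int_iterate_derivative_wScaled (c a b h k : ℕ) :
    ∃ P : ℤ[X], derivative^[k] (Waldschmidt1980.wScaled c a b h) =
      Polynomial.C ((wDen a b h : ℚ)⁻¹) * P.map (Int.castRingHom ℚ) := by
  refine ⟨derivative^[k] ((∏ i : Slot a b h, (X + Polynomial.C ((slotVal i : ℕ) : ℤ))).comp
    (Polynomial.C (c : ℤ) * X)), ?_⟩
  unfold Waldschmidt1980.wScaled Waldschmidt1980.wPolyQ
  rw [mul_comp, C_comp, iterate_derivative_C_mul, ← iterate_derivative_map, Polynomial.map_comp,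
    Polynomial.map_prod, Polynomial.map_mul, Polynomial.map_C, Polynomial.map_X]
  congr 3
  exact prod_congr rfl fun i _ => by rw [Polynomial.map_add, Polynomial.map_X, Polynomial.map_C]; simp

/-- **`p`-adic size of the coefficients of the `Δ`-polynomial**: every coefficient of
`(d/dX)^{τ₀} wOf` has norm `≤ ‖wDen⁻¹‖_p`. [cite: CijsouwWaldschmidt1977, §4 Lemma 8 (p. 185)] -/
theorem norm_coeff_iterate_derivative_wOf_le (J₀ J : ℕ) (u : Idx S.d h Lb) (τ₀ i : ℕ) :
    ‖(derivative^[τ₀] (S.wOf J₀ J u)).coeff i‖ ≤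
      ‖((wDen (u.1.1 : ℕ) (u.1.2 : ℕ) h : ℕ) : ℚ_[S.p])⁻¹‖ := by
  obtain ⟨P, hP⟩ := exists_int_iterate_derivative_wScaled (2 ^ (J₀ - J)) (u.1.1 : ℕ) (u.1.2 : ℕ) h τ₀
  unfold wOf
  rw [iterate_derivative_map, hP, Polynomial.map_mul, Polynomial.map_C, Polynomial.coeff_C_mul,
    Polynomial.map_map, Polynomial.coeff_map, norm_mul, map_inv₀, map_natCast]
  refine mul_le_of_le_one_right (norm_nonneg _) ?_
  rw [show ((algebraMap ℚ ℚ_[S.p]).comp (Int.castRingHom ℚ)) (P.coeff i) = ((P.coeff i : ℤ) : ℚ_[S.p])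
    by simp]
  exact Padic.norm_int_le_one _

/-- `‖(n!)⁻¹‖_p ≤ (√p)ⁿ⁻¹ ≤ (√p)ⁿ` … in the form `‖(n!)⁻¹‖ ≤ (√p)^n`. [cite: Yu1990, Lemma 2.2] -/
theorem norm_inv_factorial_le_sqrt_pow (n : ℕ) : ‖((n ! : ℕ) : ℚ_[S.p])⁻¹‖ ≤ Real.sqrt S.p ^ n := by
  have h2 := PadicExp.norm_inv_natCast_factorial_sq_le (E := ℚ_[S.p]) (ℓ := S.p) S.hp3 n
  have hp0 : (0 : ℝ) ≤ S.p := by positivity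
  have h3 : ‖((n ! : ℕ) : ℚ_[S.p])⁻¹‖ ^ 2 ≤ (Real.sqrt S.p ^ n) ^ 2 := by
    rw [← pow_mul, mul_comm, pow_mul, Real.sq_sqrt hp0]
    exact h2.trans (pow_le_pow_right₀ S.one_lt_p.le (Nat.sub_le n 1))
  exact (pow_le_pow_iff_left₀ (norm_nonneg _) (by positivity) two_ne_zero).mp h3

/-- `‖wDen(r,l,h)⁻¹‖_p ≤ (√p)^{r + l h}`. [cite: Yu1990, Lemma 2.2] -/
theorem norm_inv_wDen_le (a b h : ℕ) :
    ‖((wDen a b h : ℕ) : ℚ_[S.p])⁻¹‖ ≤ Real.sqrt S.p ^ (a + b * h) := by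
  unfold wDen
  push_cast
  rw [mul_inv, norm_mul, ← inv_pow, norm_pow, pow_add, pow_mul]
  refine mul_le_mul (S.norm_inv_factorial_le_sqrt_pow a) ?_ (by positivity) (by positivity)
  rw [← pow_mul, mul_comm b h, pow_mul]
  exact pow_le_pow_left₀ (norm_nonneg _) (S.norm_inv_factorial_le_sqrt_pow h) b

/-! ### The coefficient sequence of `f_{J,τ}` -/

/-- The coefficients of `exp(expo(u) z)`: `expo(u)^j / j!`. [cite: Yu1990, §1.1] -/
def eC (u : Idx S.d h Lb) (j : ℕ) : ℚ_[S.p] := S.expo u ^ j / (j ! : ℚ_[S.p])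

/-- The coefficients of the `Δ`-factor `(d/dX)^{τ₀} wOf`. [cite: CijsouwWaldschmidt1977, §4 (p. 186)] -/
def wC (J₀ J : ℕ) (u : Idx S.d h Lb) (τ₀ i : ℕ) : ℚ_[S.p] := (derivative^[τ₀] (S.wOf J₀ J u)).coeff i

/-- The degree bound used to truncate: `deg (d/dX)^{τ₀} wOf`. [cite: Yu1990, Lemma 2.2] -/
def wDeg (J₀ J : ℕ) (u : Idx S.d h Lb) (τ₀ : ℕ) : ℕ := (derivative^[τ₀] (S.wOf J₀ J u)).natDegree

/-- **The coefficient sequence of `f_{J,τ}`**: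
`coeffF n = ∑_u p(u) A(u,τ') ∑_{i ≤ deg, i ≤ n} wC i · eC (n − i)`. [cite: Yu1990, Lemma 2.2] -/
def coeffF (J₀ J : ℕ) (box : Finset (Idx S.d h Lb)) (p : Idx S.d h Lb → ℤ) (τ : Tau S.d)
    (n : ℕ) : ℚ_[S.p] :=
  ∑ u ∈ box, (p u : ℚ_[S.p]) * S.A u τ.2 *
    ∑ i ∈ range (S.wDeg J₀ J u τ.1 + 1), if i ≤ n then S.wC J₀ J u τ.1 i * S.eC u (n - i) else 0

/-! ### Convergence to `f_{J,τ}` on `‖z‖ < √p` -/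

/-- `exp(expo(u) z) = ∑ⱼ eC j zʲ` for `‖z‖ < √p`. [cite: Yu1990, §1.1] -/
theorem hasSum_eC (u : Idx S.d h Lb) {z : ℚ_[S.p]} (hz : ‖z‖ < Real.sqrt S.p) :
    HasSum (fun j => S.eC u j * z ^ j) (exp (S.expo u * z)) := by
  have hmem := S.mem_eball_of_norm_lt (S.norm_expo_le u) hz
  rw [smul_eq_mul, mul_comm] at hmem
  have h := expSeries_hasSum_exp_of_mem_ball' (𝕂 := ℚ_[S.p]) (S.expo u * z) hmem
  refine h.congr_fun fun j => ?_
  rw [inv_natCast_smul_eq ℚ_[S.p] ℚ_[S.p], smul_eq_mul, eC, mul_pow]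
  field_simp

/-- `Dw(z) = ∑_{i ≤ deg} wC i zⁱ`. [cite: Yu1990, Lemma 2.2] -/
theorem Dw_eq_sum (J₀ J : ℕ) (u : Idx S.d h Lb) (τ₀ : ℕ) (z : ℚ_[S.p]) :
    S.Dw J₀ J u τ₀ z = ∑ i ∈ range (S.wDeg J₀ J u τ₀ + 1), S.wC J₀ J u τ₀ i * z ^ i := by
  unfold Dw wDeg wC
  rw [Polynomial.eval_eq_sum_range]

/-- One shifted series: `∑ₙ [i ≤ n] wC i · eC (n−i) zⁿ = wC i zⁱ · exp(expo z)`. [cite: Yu1990, Lemma 2.2] -/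
theorem hasSum_shift (J₀ J : ℕ) (u : Idx S.d h Lb) (τ₀ i : ℕ) {z : ℚ_[S.p]}
    (hz : ‖z‖ < Real.sqrt S.p) :
    HasSum (fun n => (if i ≤ n then S.wC J₀ J u τ₀ i * S.eC u (n - i) else 0) * z ^ n)
      (S.wC J₀ J u τ₀ i * z ^ i * exp (S.expo u * z)) := by
  have h := (S.hasSum_eC u hz).mul_left (S.wC J₀ J u τ₀ i * z ^ i)
  rw [← hasSum_nat_add_iff' i]
  have h0 : ∑ n ∈ range i, (if i ≤ n then S.wC J₀ J u τ₀ i * S.eC u (n - i) else 0) * z ^ n = 0 :=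
    sum_eq_zero fun n hn => by rw [if_neg (by have := mem_range.mp hn; omega), zero_mul]
  rw [h0, sub_zero]
  refine h.congr_fun fun n => ?_
  rw [if_pos (by omega), Nat.add_sub_cancel, pow_add]
  ring

/-- One term: `∑ₙ (∑ᵢ [i ≤ n] wC i eC (n−i)) zⁿ = Dw(z) · exp(expo z)`. [cite: Yu1990, Lemma 2.2] -/
theorem hasSum_term (J₀ J : ℕ) (u : Idx S.d h Lb) (τ : Tau S.d) {z : ℚ_[S.p]}
    (hz : ‖z‖ < Real.sqrt S.p) :
    HasSum (fun n => (∑ i ∈ range (S.wDeg J₀ J u τ.1 + 1),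
        (if i ≤ n then S.wC J₀ J u τ.1 i * S.eC u (n - i) else 0)) * z ^ n)
      (S.Dw J₀ J u τ.1 z * exp (S.expo u * z)) := by
  have h := hasSum_sum fun i (_ : i ∈ range (S.wDeg J₀ J u τ.1 + 1)) => S.hasSum_shift J₀ J u τ.1 i hz
  rw [S.Dw_eq_sum, sum_mul]
  refine h.congr_fun fun n => ?_
  rw [sum_mul]

/-- **`f_{J,τ}(z) = ∑ₙ coeffF n zⁿ` on `‖z‖ < √p`.** [cite: Yu1990, Lemma 2.2] -/
theorem hasSum_coeffF (J₀ J : ℕ) (box : Finset (Idx S.d h Lb)) (p : Idx S.d h Lb → ℤ) (τ : Tau S.d)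
    {z : ℚ_[S.p]} (hz : ‖z‖ < Real.sqrt S.p) :
    HasSum (fun n => S.coeffF J₀ J box p τ n * z ^ n) (S.F J₀ J box p τ z) := by
  unfold F coeffF
  have h := hasSum_sum fun u (_ : u ∈ box) =>
    (S.hasSum_term J₀ J u τ hz).mul_left ((p u : ℚ_[S.p]) * S.A u τ.2)
  have e : ∑ u ∈ box, (p u : ℚ_[S.p]) * S.A u τ.2 * (S.Dw J₀ J u τ.1 z * exp (S.expo u * z)) =
      ∑ u ∈ box, (p u : ℚ_[S.p]) * S.termF J₀ J u τ z :=
    sum_congr rfl fun u _ => by simp only [termF]; ring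
  rw [← e]
  refine h.congr_fun fun n => ?_
  rw [sum_mul]
  exact sum_congr rfl fun u _ => by ring

/-- `f_{J,τ}(z) = ∑' coeffF n zⁿ` on `‖z‖ < √p`. [cite: Yu1990, Lemma 2.2] -/
theorem F_eq_tsum (J₀ J : ℕ) (box : Finset (Idx S.d h Lb)) (p : Idx S.d h Lb → ℤ) (τ : Tau S.d)
    {z : ℚ_[S.p]} (hz : ‖z‖ < Real.sqrt S.p) :
    S.F J₀ J box p τ z = ∑' n, S.coeffF J₀ J box p τ n * z ^ n :=
  (S.hasSum_coeffF J₀ J box p τ hz).tsum_eq.symm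

/-- `f_{J,τ}` agrees with its power series near every point of `‖z‖ < √p`. [cite: Yu1990, Lemma 2.2] -/
theorem F_eventuallyEq_tsum (J₀ J : ℕ) (box : Finset (Idx S.d h Lb)) (p : Idx S.d h Lb → ℤ)
    (τ : Tau S.d) {a : ℚ_[S.p]} (ha : ‖a‖ < Real.sqrt S.p) :
    S.F J₀ J box p τ =ᶠ[𝓝 a] fun z => ∑' n, S.coeffF J₀ J box p τ n * z ^ n := by
  filter_upwards [S.ball_sqrt_mem_nhds ha] with z hz using S.F_eq_tsum J₀ J box p τ hz

/-! ### The weighted bound `‖coeffF n‖ (√p)ⁿ ≤ p^{h Lb}` -/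

/-- `‖eC j‖ (√p)ʲ ≤ 1` (`‖expo‖ ≤ p⁻¹`, `‖1/j!‖ ≤ (√p)^{j-1}… ≤ (√p)^j p^{-j}… `). [cite: Yu1990, §1.1] -/
theorem norm_eC_mul_le (u : Idx S.d h Lb) (j : ℕ) : ‖S.eC u j‖ * Real.sqrt S.p ^ j ≤ 1 := by
  have hp0 : (0 : ℝ) < S.p := by exact_mod_cast S.hp.pos
  have hsq : Real.sqrt S.p ^ j * Real.sqrt S.p ^ j = (S.p : ℝ) ^ j := by
    rw [← mul_pow, Real.mul_self_sqrt hp0.le]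
  unfold eC
  rw [div_eq_mul_inv, norm_mul, norm_pow, show ((j ! : ℚ_[S.p])) = ((j ! : ℕ) : ℚ_[S.p]) by norm_cast]
  -- `‖expo‖^j ≤ p^{-j}`, `‖1/j!‖ ≤ (√p)^j`
  have h1 : ‖S.expo u‖ ^ j ≤ ((S.p : ℝ)⁻¹) ^ j := pow_le_pow_left₀ (norm_nonneg _) (S.norm_expo_le u) j
  have h2 := S.norm_inv_factorial_le_sqrt_pow j
  calc ‖S.expo u‖ ^ j * ‖((j ! : ℕ) : ℚ_[S.p])⁻¹‖ * Real.sqrt S.p ^ j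
      ≤ ((S.p : ℝ)⁻¹) ^ j * Real.sqrt S.p ^ j * Real.sqrt S.p ^ j := by
        refine mul_le_mul_of_nonneg_right (mul_le_mul h1 h2 (norm_nonneg _) (by positivity)) (by positivity)
    _ = ((S.p : ℝ)⁻¹) ^ j * (S.p : ℝ) ^ j := by rw [mul_assoc, hsq]
    _ = 1 := by rw [← mul_pow, inv_mul_cancel₀ hp0.ne', one_pow]

/-- `‖wC i‖ (√p)ⁱ ≤ p^{h Lb}` … precisely `≤ (√p)^{deg w} (√p)^{deg w}` with `deg w = r + l h < h Lb`;
coefficients beyond the degree vanish. [cite: CijsouwWaldschmidt1977, §4 Lemma 8 (p. 185)] -/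
theorem norm_wC_mul_le (J₀ J : ℕ) (u : Idx S.d h Lb) (τ₀ i : ℕ) :
    ‖S.wC J₀ J u τ₀ i‖ * Real.sqrt S.p ^ i ≤ (S.p : ℝ) ^ (h * Lb) := by
  have hp1 : (1 : ℝ) ≤ Real.sqrt S.p := by
    rw [Real.le_sqrt zero_le_one (by positivity)]; simpa using S.one_lt_p.le
  have hp0 : (0 : ℝ) < S.p := by exact_mod_cast S.hp.pos
  set N := (u.1.1 : ℕ) + (u.1.2 : ℕ) * h with hN
  -- degree bound
  have hdeg : (derivative^[τ₀] (S.wOf J₀ J u)).natDegree ≤ N := by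
    refine (natDegree_iterate_derivative _ _).trans ((Nat.sub_le _ _).trans ?_)
    unfold wOf
    refine (natDegree_map_le).trans ?_
    rw [Waldschmidt1980.natDegree_wScaled (pow_ne_zero _ two_ne_zero)]
  have hNlt : N + N ≤ 2 * (h * Lb) := by
    have hr : (u.1.1 : ℕ) < h := u.1.1.isLt
    have hl : (u.1.2 : ℕ) + 1 ≤ Lb := u.1.2.isLt
    have : N < h * Lb := by
      calc N = (u.1.1 : ℕ) + (u.1.2 : ℕ) * h := rfl
        _ < h + (u.1.2 : ℕ) * h := by omega
        _ = ((u.1.2 : ℕ) + 1) * h := by ring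
        _ ≤ Lb * h := Nat.mul_le_mul_right _ hl
        _ = h * Lb := mul_comm _ _
    omega
  by_cases hi : i ≤ N
  · unfold wC
    calc ‖(derivative^[τ₀] (S.wOf J₀ J u)).coeff i‖ * Real.sqrt S.p ^ i
        ≤ Real.sqrt S.p ^ N * Real.sqrt S.p ^ N := by
          refine mul_le_mul ((S.norm_coeff_iterate_derivative_wOf_le J₀ J u τ₀ i).trans
            (S.norm_inv_wDen_le _ _ _)) (pow_le_pow_right₀ hp1 hi) (by positivity) (by positivity)
      _ = Real.sqrt S.p ^ (N + N) := (pow_add _ _ _).symm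
      _ ≤ Real.sqrt S.p ^ (2 * (h * Lb)) := pow_le_pow_right₀ hp1 hNlt
      _ = (S.p : ℝ) ^ (h * Lb) := by rw [pow_mul, Real.sq_sqrt hp0.le]
  · have h0 : S.wC J₀ J u τ₀ i = 0 := by
      unfold wC
      exact coeff_eq_zero_of_natDegree_lt (by omega)
    rw [h0, norm_zero, zero_mul]; positivity

/-- **The weighted coefficient bound**: `WtBdd (√p) (p^{h Lb}) coeffF` — `‖coeffF n‖ (√p)ⁿ ≤ p^{h Lb}`
(ultrametric: each `p(u) ∈ ℤ`, `‖A‖ ≤ 1`, `‖wC i‖(√p)ⁱ ≤ p^{hLb}`, `‖eC j‖(√p)ʲ ≤ 1`).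
[cite: Yu1990, Lemma 2.2] -/
theorem wtBdd_coeffF (J₀ J : ℕ) (box : Finset (Idx S.d h Lb)) (p : Idx S.d h Lb → ℤ) (τ : Tau S.d) :
    PadicNewton.WtBdd (Real.sqrt S.p) ((S.p : ℝ) ^ (h * Lb)) (S.coeffF J₀ J box p τ) := by
  intro n
  have hsp : 0 < Real.sqrt S.p ^ n := pow_pos S.sqrt_p_pos n
  rw [← le_div_iff₀ hsp]
  have hB : 0 ≤ (S.p : ℝ) ^ (h * Lb) / Real.sqrt S.p ^ n := by positivity
  unfold coeffF
  refine norm_sum_le_of_forall_le_of_nonneg hB fun u _ => ?_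
  rw [norm_mul, norm_mul]
  refine (mul_le_of_le_one_left (norm_nonneg _)
    (mul_le_one₀ (Padic.norm_int_le_one _) (norm_nonneg _) (S.norm_A_le u τ.2))).trans ?_
  refine norm_sum_le_of_forall_le_of_nonneg hB fun i _ => ?_
  split_ifs with hin
  · rw [le_div_iff₀ hsp, norm_mul]
    have e : Real.sqrt S.p ^ n = Real.sqrt S.p ^ i * Real.sqrt S.p ^ (n - i) := by
      rw [← pow_add, Nat.add_sub_cancel' hin]
    rw [e]
    calc ‖S.wC J₀ J u τ.1 i‖ * ‖S.eC u (n - i)‖ * (Real.sqrt S.p ^ i * Real.sqrt S.p ^ (n - i))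
        = (‖S.wC J₀ J u τ.1 i‖ * Real.sqrt S.p ^ i) * (‖S.eC u (n - i)‖ * Real.sqrt S.p ^ (n - i)) := by
          ring
      _ ≤ (S.p : ℝ) ^ (h * Lb) * 1 :=
          mul_le_mul (S.norm_wC_mul_le J₀ J u τ.1 i) (S.norm_eC_mul_le u (n - i)) (by positivity)
            (by positivity)
      _ = (S.p : ℝ) ^ (h * Lb) := mul_one _
  · rw [norm_zero]; exact hB

/-! ### Jets of `f_{J,τ}` from the values of the `f_{J,τ'}` -/

/-- **The jets of `f_{J,τ}` at a node are controlled by the values of the `f_{J,τ'}` there**: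
if `‖f_{J,τ'}(a)‖ ≤ ε` for all `|τ'| ≤ N` (`‖a‖ ≤ 1`), then for `|τ| + k ≤ N` the `k`-th jet of the
power series of `f_{J,τ}` at `a` has norm `≤ ‖(k!)⁻¹‖_p · ε`. This is the hypothesis `hjet` of
`PadicNewton.norm_tsum_le_max_of_small_jets` (radius `ρ = √p`, `r = 1`).
[cite: Yu1990, Lemma 2.4] [cite: CijsouwWaldschmidt1977, §4 (11) (p. 189)] -/
theorem norm_jet_F_le (J₀ J : ℕ) (box : Finset (Idx S.d h Lb)) (p : Idx S.d h Lb → ℤ)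
    {a : ℚ_[S.p]} (ha : ‖a‖ ≤ 1) (N : ℕ) {ε : ℝ} (hε0 : 0 ≤ ε)
    (hε : ∀ τ : Tau S.d, tauNorm τ ≤ N → ‖S.F J₀ J box p τ a‖ ≤ ε)
    (k : ℕ) (τ : Tau S.d) (hk : tauNorm τ + k ≤ N) :
    ‖PadicNewton.jet a (S.coeffF J₀ J box p τ) k‖ ≤ ‖((k ! : ℕ) : ℚ_[S.p])⁻¹‖ * ε := by
  have h3 : (1 : ℝ) < Real.sqrt S.p := by
    rw [Real.lt_sqrt zero_le_one]; norm_num; exact_mod_cast S.hp.one_lt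
  have ha' : ‖a‖ < Real.sqrt S.p := lt_of_le_of_lt ha h3
  have hb := S.wtBdd_coeffF J₀ J box p τ
  have hj := PadicNewton.norm_jet_le_norm_iteratedDeriv S.sqrt_p_pos h3 one_pos hb ha k
  refine hj.trans (mul_le_mul_of_nonneg_left ?_ (norm_nonneg _))
  rw [← (S.F_eventuallyEq_tsum J₀ J box p τ ha').iteratedDeriv_eq k]
  exact S.norm_iteratedDeriv_F_le_of_forall J₀ J box p ha' N hε0 hε k τ hk

end Setup

end PadicCW77

end Literature.NumberTheory.Transcendental

end
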